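import Literature.Analysis.Calculus.QuadraticSolutionMapDeriv
import HarnessLib

/-!
# The solution map of `w = A g − J Q(w, w)`: invariance of closed sets

Analysis/Calculus support file (everything proved; no definitions, no named facts), companion of
`QuadraticSolutionMapDeriv.lean`.  Same construction and conclusions as
`exists_solutionMap_hasStrictFDerivAt` (the solution map `sol` of `w = A g − J (Q w w)` near
`g = 0` on a Banach space, its Lipschitz bound and its strict derivative `A` at `0`), with ONE MORE
conclusion, the **invariance principle**: if `S` is a closed subset containing `0` and the
fixed-point map `w ↦ A g − J Q(w,w)` sends `S ∩ B̄(0, ρ)` into `S`, then `sol g ∈ S` (the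
contraction restricted to the complete set `S ∩ B̄(0, ρ)` has a fixed point there, equal to
`sol g` by uniqueness in the ball).  This is how qualitative properties of the datum that are
preserved by the free evolution and by the nonlinearity (spatial decay at infinity, weak
divergence-freeness, symmetries) are inherited by the solution of a semilinear integral equation
without any a-priori estimate (Henry 1981, §3.3–3.4).  Only Banach's fixed point theorem is used.

## Mathlib / tree search

Tree: `Literature.Analysis.Calculus.exists_isFixedPt_mem_closedBall`,
`Literature.Analysis.Calculus.norm_bilinear_diag_sub_le` (`QuadraticSolutionMapDeriv.lean`).
Mathlib: `ContractingWith.exists_fixedPoint'`, `IsClosed.isComplete`,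
`hasStrictFDerivAt_iff_isLittleO`.

## References

* D. Henry, *Geometric Theory of Semilinear Parabolic Equations*, LNM 840 (1981), §3.3–3.4.
  [Henry1981]
-/

noncomputable section

open Set Metric Filter Asymptotics Function
open _root_.Topology

namespace Literature.Analysis.Calculus

variable {G X : Type*} [NormedAddCommGroup G] [NormedSpace ℝ G]
  [NormedAddCommGroup X] [NormedSpace ℝ X] [CompleteSpace X]

/-- **The solution map of `w = A g − J Q(w,w)`, its strict derivative at `0`, and the invariance of
closed sets.**  As `exists_solutionMap_hasStrictFDerivAt`, plus: for every closed `S ∋ 0` and every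
`‖g‖ < r` such that `w ↦ A g − J (Q w w)` maps `S ∩ B̄(0, ρ)` into `S`, the solution `sol g` lies in
`S`. (Henry 1981, §3.3–3.4.) [cite: Henry1981, Thm 3.4.4] -/
theorem exists_solutionMap_hasStrictFDerivAt_invariant (A : G →L[ℝ] X) (J : X →L[ℝ] X)
    (Q : X →L[ℝ] X →L[ℝ] X) :
    ∃ r : ℝ, 0 < r ∧ ∃ ρ : ℝ, 0 < ρ ∧ ∃ sol : G → X,
      sol 0 = 0 ∧
      (∀ g, ‖g‖ < r → ‖sol g‖ ≤ ρ ∧ sol g = A g - J (Q (sol g) (sol g))) ∧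
      (∀ g w, ‖g‖ < r → ‖w‖ ≤ ρ → w = A g - J (Q w w) → w = sol g) ∧
      (∀ g₁ g₂, ‖g₁‖ < r → ‖g₂‖ < r → ‖sol g₁ - sol g₂‖ ≤ 2 * ‖A‖ * ‖g₁ - g₂‖) ∧
      (∀ g, ‖g‖ < r → ‖sol g‖ ≤ 2 * ‖A‖ * ‖g‖) ∧
      HasStrictFDerivAt sol A 0 ∧
      (∀ S : Set X, IsClosed S → (0 : X) ∈ S →
        ∀ g, ‖g‖ < r → (∀ w ∈ S, ‖w‖ ≤ ρ → A g - J (Q w w) ∈ S) → sol g ∈ S) := by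
  classical
  set a : ℝ := ‖A‖ with ha
  set j : ℝ := ‖J‖ with hj
  set q : ℝ := ‖Q‖ with hq
  have ha0 : 0 ≤ a := norm_nonneg A
  have hj0 : 0 ≤ j := norm_nonneg J
  have hq0 : 0 ≤ q := norm_nonneg Q
  set ρ : ℝ := 1 / (4 * (j * q + 1)) with hρ
  have hρ0 : 0 < ρ := by positivity
  have hjqρ : j * q * ρ ≤ 1 / 4 := by
    rw [hρ, mul_one_div, div_le_iff₀ (by positivity)]
    nlinarith
  set r : ℝ := ρ / (2 * (a + 1)) with hr
  have hr0 : 0 < r := by positivity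
  have har : a * r ≤ ρ / 2 := by
    rw [hr]
    rw [mul_div_assoc']
    rw [div_le_div_iff₀ (by positivity) (by positivity)]
    nlinarith
  -- the contraction `Φ g w = A g − J (Q w w)` on the closed ball of radius `ρ`
  set Φ : G → X → X := fun g w => A g - J (Q w w) with hΦ
  have hΦlip : ∀ g w₁ w₂, ‖w₁‖ ≤ ρ → ‖w₂‖ ≤ ρ →
      ‖Φ g w₁ - Φ g w₂‖ ≤ (1 / 2) * ‖w₁ - w₂‖ := by
    intro g w₁ w₂ hw₁ hw₂
    have h1 : Φ g w₁ - Φ g w₂ = -(J (Q w₁ w₁ - Q w₂ w₂)) := by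
      simp only [hΦ, map_sub]; abel
    rw [h1, norm_neg]
    calc ‖J (Q w₁ w₁ - Q w₂ w₂)‖ ≤ j * ‖Q w₁ w₁ - Q w₂ w₂‖ := J.le_opNorm _
      _ ≤ j * (q * (‖w₁‖ + ‖w₂‖) * ‖w₁ - w₂‖) := by
          gcongr; exact norm_bilinear_diag_sub_le Q w₁ w₂
      _ = (j * q * (‖w₁‖ + ‖w₂‖)) * ‖w₁ - w₂‖ := by ring
      _ ≤ (j * q * (ρ + ρ)) * ‖w₁ - w₂‖ := by gcongr
      _ = (2 * (j * q * ρ)) * ‖w₁ - w₂‖ := by ring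
      _ ≤ (2 * (1 / 4)) * ‖w₁ - w₂‖ := by gcongr
      _ = (1 / 2) * ‖w₁ - w₂‖ := by ring
  have hΦmaps : ∀ g, ‖g‖ < r → MapsTo (Φ g) (closedBall 0 ρ) (closedBall 0 ρ) := by
    intro g hg w hw
    rw [mem_closedBall_zero_iff] at hw ⊢
    have hQ : ‖J (Q w w)‖ ≤ ρ / 4 := by
      calc ‖J (Q w w)‖ ≤ j * ‖Q w w‖ := J.le_opNorm _
        _ ≤ j * (q * ‖w‖ * ‖w‖) := by gcongr; exact Q.le_opNorm₂ _ _
        _ = (j * q * ‖w‖) * ‖w‖ := by ring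
        _ ≤ (j * q * ρ) * ρ := by gcongr
        _ ≤ (1 / 4) * ρ := by gcongr
        _ = ρ / 4 := by ring
    calc ‖Φ g w‖ ≤ ‖A g‖ + ‖J (Q w w)‖ := norm_sub_le _ _
      _ ≤ a * ‖g‖ + ρ / 4 := add_le_add (A.le_opNorm _) hQ
      _ ≤ a * r + ρ / 4 := by gcongr
      _ ≤ ρ / 2 + ρ / 4 := by gcongr
      _ ≤ ρ := by linarith
  have hΦlipOn : ∀ g, LipschitzOnWith (1 / 2 : NNReal) (Φ g) (closedBall 0 ρ) := by
    intro g
    refine LipschitzOnWith.of_dist_le_mul fun w₁ hw₁ w₂ hw₂ => ?_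
    rw [dist_eq_norm, dist_eq_norm]
    have := hΦlip g w₁ w₂ (mem_closedBall_zero_iff.1 hw₁) (mem_closedBall_zero_iff.1 hw₂)
    simpa using this
  -- existence of a fixed point in the ball, and uniqueness there
  have hex : ∀ g, ‖g‖ < r → ∃ w ∈ closedBall (0 : X) ρ, Φ g w = w := fun g hg =>
    exists_isFixedPt_mem_closedBall hρ0.le (K := 1 / 2) (by norm_num) (hΦmaps g hg) (hΦlipOn g)
  have huniq : ∀ g w₁ w₂, ‖w₁‖ ≤ ρ → ‖w₂‖ ≤ ρ → Φ g w₁ = w₁ → Φ g w₂ = w₂ → w₁ = w₂ := by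
    intro g w₁ w₂ hw₁ hw₂ h1 h2
    have h := hΦlip g w₁ w₂ hw₁ hw₂
    rw [h1, h2] at h
    have : ‖w₁ - w₂‖ ≤ 0 := by linarith [norm_nonneg (w₁ - w₂)]
    exact sub_eq_zero.1 (norm_le_zero_iff.1 this)
  -- the solution map
  set sol : G → X := fun g => if hg : ‖g‖ < r then (hex g hg).choose else 0 with hsol
  have hsol_spec : ∀ g, ‖g‖ < r → ‖sol g‖ ≤ ρ ∧ Φ g (sol g) = sol g := by
    intro g hg
    have h := (hex g hg).choose_spec
    simp only [hsol, dif_pos hg]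
    exact ⟨mem_closedBall_zero_iff.1 h.1, h.2⟩
  -- Lipschitz dependence on the datum
  have hLip : ∀ g₁ g₂, ‖g₁‖ < r → ‖g₂‖ < r → ‖sol g₁ - sol g₂‖ ≤ 2 * a * ‖g₁ - g₂‖ := by
    intro g₁ g₂ hg₁ hg₂
    obtain ⟨hb₁, he₁⟩ := hsol_spec g₁ hg₁
    obtain ⟨hb₂, he₂⟩ := hsol_spec g₂ hg₂
    have hA' : Φ g₁ (sol g₂) - Φ g₂ (sol g₂) = A (g₁ - g₂) := by
      simp only [hΦ, map_sub]; abel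
    have hsplit : sol g₁ - sol g₂ = (Φ g₁ (sol g₁) - Φ g₁ (sol g₂)) + A (g₁ - g₂) := by
      calc sol g₁ - sol g₂ = Φ g₁ (sol g₁) - Φ g₂ (sol g₂) := by rw [he₁, he₂]
        _ = (Φ g₁ (sol g₁) - Φ g₁ (sol g₂)) + (Φ g₁ (sol g₂) - Φ g₂ (sol g₂)) := by abel
        _ = (Φ g₁ (sol g₁) - Φ g₁ (sol g₂)) + A (g₁ - g₂) := by rw [hA']
    have key : ‖sol g₁ - sol g₂‖ ≤ (1 / 2) * ‖sol g₁ - sol g₂‖ + a * ‖g₁ - g₂‖ := by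
      have h3 := hΦlip g₁ (sol g₁) (sol g₂) hb₁ hb₂
      calc ‖sol g₁ - sol g₂‖ = ‖(Φ g₁ (sol g₁) - Φ g₁ (sol g₂)) + A (g₁ - g₂)‖ := by rw [← hsplit]
        _ ≤ ‖Φ g₁ (sol g₁) - Φ g₁ (sol g₂)‖ + ‖A (g₁ - g₂)‖ := norm_add_le _ _
        _ ≤ (1 / 2) * ‖sol g₁ - sol g₂‖ + a * ‖g₁ - g₂‖ := add_le_add h3 (A.le_opNorm _)
    linarith
  have hsol0 : sol 0 = 0 := by
    have h0r : ‖(0 : G)‖ < r := by simpa using hr0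
    obtain ⟨hb, he⟩ := hsol_spec 0 h0r
    have hfix0 : Φ 0 0 = 0 := by simp [hΦ]
    exact huniq 0 _ _ hb (by simpa using hρ0.le) he hfix0
  have hbound : ∀ g, ‖g‖ < r → ‖sol g‖ ≤ 2 * a * ‖g‖ := by
    intro g hg
    have h := hLip g 0 hg (by simpa using hr0)
    simpa [hsol0] using h
  refine ⟨r, hr0, ρ, hρ0, sol, hsol0, fun g hg => ?_, fun g w hg hw hfix => ?_, hLip, hbound, ?_,
    fun S hS h0S g hg hinv => ?_⟩
  · exact ⟨(hsol_spec g hg).1, (hsol_spec g hg).2.symm⟩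
  · obtain ⟨hb, he⟩ := hsol_spec g hg
    exact huniq g w (sol g) hw hb hfix.symm he
  · -- strict differentiability at `0` with derivative `A`
    rw [hasStrictFDerivAt_iff_isLittleO, Asymptotics.isLittleO_iff]
    intro c hc
    -- near `(0, 0)` both components are in the `r`-ball and small
    set η : ℝ := min r (c / (8 * a ^ 2 * j * q + 1)) with hη
    have hη0 : 0 < η := by positivity
    have hmem : Metric.ball (0 : G × G) η ∈ 𝓝 ((0 : G), (0 : G)) := Metric.ball_mem_nhds _ hη0
    filter_upwards [hmem] with p hp
    rw [mem_ball_zero_iff] at hp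
    have hp1 : ‖p.1‖ < η := (norm_fst_le p).trans_lt hp
    have hp2 : ‖p.2‖ < η := (norm_snd_le p).trans_lt hp
    have hr1 : ‖p.1‖ < r := hp1.trans_le (min_le_left _ _)
    have hr2 : ‖p.2‖ < r := hp2.trans_le (min_le_left _ _)
    obtain ⟨hb₁, he₁⟩ := hsol_spec p.1 hr1
    obtain ⟨hb₂, he₂⟩ := hsol_spec p.2 hr2
    -- the remainder is `−J(Q w₁ w₁ − Q w₂ w₂)`
    have hrem : sol p.1 - sol p.2 - A (p.1 - p.2) =
        -(J (Q (sol p.1) (sol p.1) - Q (sol p.2) (sol p.2))) := by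
      conv_lhs => rw [← he₁, ← he₂]
      simp only [hΦ, map_sub]; abel
    rw [hrem, norm_neg]
    have hw12 : ‖sol p.1 - sol p.2‖ ≤ 2 * a * ‖p.1 - p.2‖ := hLip p.1 p.2 hr1 hr2
    have hw1 : ‖sol p.1‖ ≤ 2 * a * ‖p.1‖ := hbound p.1 hr1
    have hw2 : ‖sol p.2‖ ≤ 2 * a * ‖p.2‖ := hbound p.2 hr2
    have hsmall : 8 * a ^ 2 * j * q * η ≤ c := by
      have h1 : η ≤ c / (8 * a ^ 2 * j * q + 1) := min_le_right _ _
      have h2 : 8 * a ^ 2 * j * q * η ≤ (8 * a ^ 2 * j * q + 1) * η := by nlinarith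
      calc 8 * a ^ 2 * j * q * η ≤ (8 * a ^ 2 * j * q + 1) * η := h2
        _ ≤ (8 * a ^ 2 * j * q + 1) * (c / (8 * a ^ 2 * j * q + 1)) := by gcongr
        _ = c := by field_simp
    calc ‖J (Q (sol p.1) (sol p.1) - Q (sol p.2) (sol p.2))‖
        ≤ j * ‖Q (sol p.1) (sol p.1) - Q (sol p.2) (sol p.2)‖ := J.le_opNorm _
      _ ≤ j * (q * (‖sol p.1‖ + ‖sol p.2‖) * ‖sol p.1 - sol p.2‖) := by
          gcongr; exact norm_bilinear_diag_sub_le Q _ _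
      _ ≤ j * (q * (2 * a * ‖p.1‖ + 2 * a * ‖p.2‖) * (2 * a * ‖p.1 - p.2‖)) := by gcongr
      _ = (8 * a ^ 2 * j * q * ((‖p.1‖ + ‖p.2‖) / 2)) * ‖p.1 - p.2‖ := by ring
      _ ≤ (8 * a ^ 2 * j * q * η) * ‖p.1 - p.2‖ := by
          gcongr
          linarith
      _ ≤ c * ‖p.1 - p.2‖ := by gcongr
  · -- invariance of closed sets: the contraction restricted to `S ∩ B̄(0, ρ)` has a fixed point
    -- there, which is `sol g` by uniqueness in the ball
    set S' : Set X := S ∩ closedBall 0 ρ with hS'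
    have hS'c : IsComplete S' := (hS.inter isClosed_closedBall).isComplete
    have hmaps' : MapsTo (Φ g) S' S' := by
      intro w hw
      refine ⟨hinv w hw.1 (mem_closedBall_zero_iff.1 hw.2), hΦmaps g hg hw.2⟩
    have hlip' : LipschitzOnWith (1 / 2 : NNReal) (Φ g) S' :=
      (hΦlipOn g).mono inter_subset_right
    have hcw : ContractingWith (1 / 2 : NNReal) (hmaps'.restrict (Φ g) S' S') :=
      ⟨by norm_num, hlip'.mapsToRestrict hmaps'⟩
    have h0S' : (0 : X) ∈ S' := ⟨h0S, mem_closedBall_self hρ0.le⟩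
    obtain ⟨y, hyS', hfix, -⟩ := hcw.exists_fixedPoint' hS'c hmaps' h0S' (edist_ne_top _ _)
    have hy : y = sol g :=
      huniq g y (sol g) (mem_closedBall_zero_iff.1 hyS'.2) (hsol_spec g hg).1 hfix (hsol_spec g hg).2
    rw [← hy]
    exact hyS'.1


end Literature.Analysis.Calculus

end
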